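import Summits.QuantumFields.YangMills.Theorems.BalabanUVNodesN10B13KernelTowerWalksEntrywiseNumerals
import Literature.MathematicalPhysics.QuantumFieldTheory.Balaban1983to89.Node00.CarriersB13DecoratedTower

/-!
# BalabanUVNodes ∕ N10 AT THE DECORATED KERNEL TOWER OF RECORD — the ENTRYWISE-WITH-LOCATED-NUMERALS junction of [Balaban1988RG2Cluster] Lemmas 1–3 AT THE LAYER
# `lamD.toC.toK.layer` of a DECORATED residual layer `lamD : Node00.ResidB13D θ` (`Node00/CarriersB13DecoratedTower`, storey S6 of the term tower; D-0149
# width seat `pub-ymgap-dag-n10-w3`): NODE A's object data `P locF Δ₀ J C` ARE THE LAYER's OWN FIELDS, its one operator per term IS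
# `Cᵀ·sDecorate_J(½raw(Δ₀) ⊕ ½raw(Δ₀)ᵀ)·C` BY DEFINITION (`hKK` `rfl`) and the kernels of record ARE that operator's blocks (`hKA2 hKG2 hKloc` `rfl`)
# (Track A, DAG node N10 [B13]; seat `pub-ymgap-dag-n10-c` g13, module 67; the lane's follow-up of W-SEAT BRIEF §3 (C), census v14 class A0 ∕ trigger (t-A0′))

WHY (census `HOME/pub-ymgap-dag-n10-c/N10-RESIDUAL-CENSUS-v14.md`, «What would move N10 next» item 1).  At def-B13's kernel tower S4 the junctions had to POSIT one
operator per term (`KK`), three object identities reading the kernels off its blocks (`hKA2 hKG2 hKloc`) and the identity `hKK` tying the operator to NODE A's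
object data `(P, locF, Δ₀, J, C)`.  Storeys S5 (`ResidB13C`, p582159) and S6 (`ResidB13D`, p584488) of the D-0149 width seat n10-w3 make ALL of them definitional:
`ResidB13D` carries `P locF Δ₀ J Cm` per term, `toC.KK := decoratedOp Δ₀ J Cm` (print's `C*Δ_k(σ,𝐔,𝐉)C` after (2.5)–(2.6) with the s-decoration (2.8) of the
symmetrised entry expansion — the 32 ∕ 51B ∕ 51C right-hand side verbatim), `toC.toK.𝒦 := condKernels …`.  THIS FILE is module 64 keyed two
storeys down: the junction AT `lamD.toC.toK` with `KK hKA2 hKG2 hKloc hfibΛ hKK` and the data `P locF Δ₀ J C` SUPPLIED from the record's faces (`ResidB13D.toC_hKK ∕ toC_hKA2 ∕ toC_hKG2 ∕ toC_hKloc`,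
`ResidB13C.toK_hfibΛ_of_hfibN`) and fields (`lamD.P ∕ locF ∕ Δ₀ ∕ J ∕ Cm`); every other binder verbatim, read at `lamD.toC.toK`. With n10-w1's located numerals (module 64) this is THE SHORTEST DISPLAY of the N10 junction of record: NODE A = the record's own object data + their letters; (2.24)–(2.26) = three located numerals.

HONEST FRAMING.  Count-neutral kernel bookkeeping BY NAME over LANDED modules; `lamD.Δ₀ ∕ lamD.J ∕ lamD.Cm ∕ lamD.locF ∕ lamD.P` are DATA of the layer —
NOTHING of Bałaban's `Δ_k`, `G_k(U)`, `Q`, averaging operators is constructed or asserted (NODE 00's reading ∕ N06's Sect.-B road ∕ def-Y own them); NODE A's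
ENTRYWISE letters `hEL` (road of record: module 58B for inverse pieces; range + bound + holomorphy for local pieces — `B13PolynomialRangeLetters`), the geodesic
letter `hGJ`, `hCle hCsupp`, ONE positivity `hKacc`, the Lemma 1–2 located inputs about the HIDDEN frame (N09 ∕ N07 ∕ N06 in-edges), the rung `rf` and the
numerics REMAIN HYPOTHESES, now about the record's own fields; dag-n10-d's ₁₃ pin algebra (PIN-ALGEBRA ONE-DECLARER) untouched — the conclusion is the
Stage-3-keyed `Node00.B13LeafOfRecord θ lamD.toC.toK.layer` BY NAME.  N10 NOT discharged; K1⁷ NOT closed; counts unmoved; one finite four-torus programme at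
fixed ε per run; nothing continuum ∕ ℝ⁴ ∕ OS ∕ mass-gap ∕ Clay.  0 `sorry`, 0 `def`, standard axioms.  Filed `--kind proof --supports` K1⁷ «StabilityBAtRecordR13SepCoPH»
(stmt-QuantumFields-20542) `--as helper` of route «BalabanUVNodes».

WHAT THIS FILE PROVES.  §1 `b13LeafOfRecord_decLayer_of_located_entrywise_numerals` ⟹ `B13LeafOfRecord θ lamD.toC.toK.layer`.  Generated from the source signature by the lineage's `HOME/tools/gen_dec.py`
(`lamK ↦ lamD.toC.toK`, `KK ↦ lamD.toC.KK`, `P ∕ locF ∕ Δ₀ ∕ J ∕ C ↦ lamD.…`); w3's scratch certificate `scratch_junction_51C_at_decoratedTower.lean` is the same shape.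

References (TYPES and page anchors only): [II] = [Balaban1988RG2Cluster] Lemma 1 p.9, Lemma 2 p.11, Lemma 3 p.20, p.3, (1.11) p.5, (2.3) p.12, (2.5)–(2.8)
pp.12–14, (2.14)–(2.26) pp.15–17, p.21; [B9] = [Balaban1985BackgroundPropagators] (3.93) p.410, Thm 3.4 p.400, (3.62)–(3.64) p.402, Thm 3.10 (3.107)–(3.108) p.416,
Thm 3.12 p.423; [Balaban1984PropagatorsII] Lemma 2.1 (2.61) p.234.
A2 ∕ A6 (director-ym №189 STANDING A6 RULE; v1.0.1).  The displayed binder blocks are INHABITED BY CITED TREE TERMS, block by block, with genuine σ- and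
u-dependence: (v) NODE A about the record's own fields + (iv) the rung at ONE admissible package — n10-w2's `B13EntrywiseBlockRungWitness.
entrywiseBlockRung_joint_nonvacuous` (p586283; binder text verbatim) and, AT A DECORATED DATUM OF THIS VERY TOWER over any g0 layer, n10-w3's
`Node00.CarriersB13DecoratedTowerWitness` (p588148: `ResidB13.blockDecorated`, faces `blockDecorated_toC_KK ∕ _Δ₀ ∕ _J ∕ _Cm ∕ _locF ∕ _X` (`rfl`),
`termWalksRef_blockDecorated`, `exists_residB13D_termWalksRef(_circle)` — non-empty σ-regions, a decorated pair, a non-symmetric `Δ₀`, `Y0l ∩ Pl = ∅`); the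
exchange pair `hαsmall hRσlarge` for EVERY `θ₀ > 0` jointly with (iv)+(v) — n10-w2's `B13EntrywiseBlockRungExchangeWitness.entrywiseBlockRungExchange_joint_
nonvacuous` (p587888); the three located numerals `hθle hγle hM4` — n10-w1's `B13Bound226Numerals.exists_letters` (p583431), and jointly with the Lemma-3 numerics
bundle `hN h12 …` and the Lemma-1 thresholds at ONE constants record — `B13ChainJointNonvacuity226.chain_joint_nonvacuous_226` (p586209).  HONEST LIMITS: (a) a
SINGLE inhabitant of all ≈135 binders at once is NOT exhibited (the blocks' witnesses live at different letters: w3's datum is keyed at the layer's `c.κ₁`, the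
junction's `hP2` at `cp.κ₁ > c.κ₁`; (B″)'s package `nodeAPackageX … θ₀` differs from (B′)'s `nodeAPackage`); (b) the Lemma 1–2 located inputs about the HIDDEN
frame are inhabited by the zero term tower (director №195 (6) «ZEROTOWER», def-B13's relocated lever `unitDecorated_H`) — their content is the in-edges'; (c)
`hPa` and `hcount` are located numerals about the record's `r_P` and bond counts, inhabited trivially for small `g` ∕ large `a₅` and not otherwise witnessed.
v1.0.2 (docstring-only; declarations byte-identical) — ★ VACUITY NOTE (A6, dag-n10-w3 g4 `B13CountBinderObstruction`, p612518): limit (c) above is WRONG as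
hoped — «large `a₅`» is NOT available: `hN` (`Lemma3Numerics`: `a₅ < c.δ·ℓ·c.κ∕64`) caps `a₅`, and at `Z` = the whole coarse torus with the admissible term
`(∅, all bonds)` the θ-FREE count `hcount` ∧ `hPcard` ∧ `hN` force `1280·(m₃+1)⁴·(ℓ₆+1)³ < c.δ·c.κ`, which EVERY constants family in the tree violates (`δκ < 672`:
`no_joint_inhabitant_of_consts ∕ _constsQ8 ∕ _constsQ8A`, `count_binders_false_of_delta_kappa_le`).  Hence the binder set of THIS file (and of 67R ∕ 67RD ∕ 67RDL,
which inherit `hcount`) has NO joint inhabitant at the tree's constants families — the theorem is true as stated, its hypothesis list is not jointly satisfiable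
there.  The artefact is the lane's adoption (module 64) of `B13Bound226Numerals.vol_of_counts`' θ-free CONCLUSION as a binder (worst-case per-row-bond cost
«2|Λ| + ½|Λ ⊕ C₀|» frozen in); print's p. 20 count is dial-weighted («O(1)(LM)⁴α₅», α₅ small) = module 51C ∕ `…EntrywiseDecorated`'s `hvol`, which is met for any
object sizes by small `θ₀ ∕ γ₂ ∕ α₄M⁻⁴` (`B13CountBinderObstruction.dialCount_le_of_dials`).  THE DISPLAY OF RECORD of the N10 junction is therefore the
dial-weighted sibling 67V `…EntrywiseNumeralsDecoratedDialsLocatedVol` (n10-w3 g4, p614443 ✓ 4f186d499936; `hcount ↦ hvol`, `θ₀ ≤ θ₀max` free), lane word INBOX l.31366;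
census `HOME/pub-ymgap-dag-n10-c/N10-RESIDUAL-CENSUS-v18.md`.  Nothing of Bałaban's asserted or denied by this note.
-/

noncomputable section

namespace Summit.QuantumFields.YangMills.BalabanUVNodes.N10B13KernelTowerWalksEntrywiseNumeralsDecorated

open Literature.MathematicalPhysics.QuantumFieldTheory.Balaban1983to89
open Literature.MathematicalPhysics.QuantumFieldTheory.Balaban1983to89.DagBinding
open Literature.MathematicalPhysics.QuantumFieldTheory.Balaban1983to89.Node00
open Literature.MathematicalPhysics.QuantumFieldTheory.Balaban1983to89.B13Lemma3Torus (TwoTorusStep)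
open Literature.MathematicalPhysics.QuantumFieldTheory.Balaban1983to89.B13Lemma3TorusSocket (TermDomination Lemma3Numerics)
open Literature.MathematicalPhysics.QuantumFieldTheory.Balaban1983to89.B13Lemma3TorusData
open Metric
open Literature.MathematicalPhysics.QuantumFieldTheory.Balaban1983to89.B16Absorption (pbox)
open Literature.MathematicalPhysics.QuantumFieldTheory.Balaban1983to89.TreeLengthTorus
open Literature.MathematicalPhysics.QuantumFieldTheory.Balaban1983to89.TreeLengthTorusGeometry
open Literature.MathematicalPhysics.QuantumFieldTheory.Balaban1983to89.TreeLengthTorusTransfer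
open Literature.MathematicalPhysics.QuantumFieldTheory.Balaban1983to89.B12TreeDecay (kappa₀ K₀)
open Literature.MathematicalPhysics.QuantumFieldTheory.Balaban1983to89.B13PkScaling (Qop scaled)
open Literature.MathematicalPhysics.QuantumFieldTheory.Balaban1983to89.B13Bound143 (invTau R12)
open Literature.MathematicalPhysics.QuantumFieldTheory.Balaban1983to89.B13Term214 (term214 SepHolOn core214 F214)
open Literature.MathematicalPhysics.QuantumFieldTheory.Balaban1983to89.B13Lemma3TorusTerms (terms Z0)
open Literature.MathematicalPhysics.QuantumFieldTheory.Balaban1983to89.B5TorusCover (UT)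
open Literature.MathematicalPhysics.QuantumFieldTheory.Balaban1983to89.B13TermWalkData (TermKernels)
open Literature.MathematicalPhysics.QuantumFieldTheory.Balaban1983to89.NodeOLettersOfWalksAcross (WalkPackage TermWalks)
open Literature.MathematicalPhysics.QuantumFieldTheory.Balaban1983to89.NodeOLettersOfWalksPerturbative (RefPackage TermWalksRef)
open Literature.MathematicalPhysics.QuantumFieldTheory.Balaban1983to89.B13Sqrt27Accretive (invSqrt)
open Literature.MathematicalPhysics.QuantumFieldTheory.Balaban1983to89.B9Thm37GlueTorus (tdist1)
open Literature.MathematicalPhysics.QuantumFieldTheory.Balaban1983to89.B13Eq111SDecoupling (sDecorate)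
open Literature.MathematicalPhysics.QuantumFieldTheory.Balaban1983to89.B13EntrywiseWalks (RawEntryLetters GeodesicDecoration rawEntryTerm)
open Summit.QuantumFields.YangMills.BalabanUVNodes.N10AtRecord11B13WalksBlockEntrywise (b13LeafOfRecord_of_located_entrywise)
open Summit.QuantumFields.YangMills.BalabanUVNodes.N10B13KernelTowerWalksHolo (measurable_chiY₀)
open scoped Matrix
open Summit.QuantumFields.YangMills.BalabanUVNodes.N10B13KernelTowerWalksEntrywiseNumerals (b13LeafOfRecord_layer_of_located_entrywise_numerals)
open Literature.MathematicalPhysics.QuantumFieldTheory.Balaban1983to89.B13Bound226Numerals (theta0Max gamma2Max m4Min)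

/-! ## §1. THE ENTRYWISE-WITH-LOCATED-NUMERALS JUNCTION AT THE DECORATED TOWER — NODE A's object data are the layer's fields; the operator and the kernels are definitional -/

section DecLayer

variable (θ : Stage3Params) (lamD : ResidB13D θ)

-- the junction elaborates ≈ 150 binders and a 160–170-argument application; twice the default budget (as the source junction)
set_option maxHeartbeats 400000 in
open Classical in
/-- **THE [B13] LEAF AT THE DECORATED KERNEL TOWER OF RECORD (ENTRYWISE-WITH-LOCATED-NUMERALS).**  At Stage-3 parameters `θ` and a DECORATED residual layer `lamD : ResidB13D θ`
(per term: fine-bond index `lamD.P Z t` located by `lamD.locF`, σ-free fluctuation operator `lamD.Δ₀ Z t` on the complex chart ball, cube decoration `lamD.J Z t` on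
pairs of fine bonds, real local averaging operator `lamD.Cm Z t`, reference laws), this is `module 64's `b13LeafOfRecord_layer_of_located_entrywise_numerals`` at `lamD.toC.toK` with
`KK hKA2 hKG2 hKloc hfibΛ hKK` and the data `P locF Δ₀ J C` SUPPLIED (`rfl` faces of storeys S5∕S6 and the record's fields).  The remaining binders are the source's, read at `lamD.toC.toK`: the Lemma 1–2
located inputs about the hidden frame, the numerics, `cp ∕ hκp`, `0 < r ≤ 1`, the record's objects, measurability, the reference package `rf` with print's four
perturbative thresholds, `hKX`, NODE A's LETTERS about the record's own fields (`hEL hfibF hGJ` + (1.11) numerics + `hCle hCsupp` + letter match + ONE positivity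
`hKacc` + `hKfar hKmult hKdim` + dominations), the exchange thresholds, the smallness, `hPa`, the volume binder.  CONCLUSION `B13LeafOfRecord θ lamD.toC.toK.layer`.
Count-neutral: hypotheses about the HIDDEN frame and the letters of the record's own object data; nothing of Bałaban's is asserted.
[cite: Balaban1988RG2Cluster, Lemma 1 p.9, Lemma 2 p.11, Lemma 3 p.20, p.3, (1.11) p.5, (2.3) p.12, (2.5)–(2.8) pp.12–14, (2.14)–(2.26) pp.15–17; Balaban1985BackgroundPropagators, (3.93) p.410, Thm 3.4 p.400, (3.62)–(3.64) p.402, Thm 3.10 (3.107)–(3.108) p.416, Thm 3.12 p.423] -/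
theorem b13LeafOfRecord_decLayer_of_located_entrywise_numerals
    (hN12 : 12 ≤ (θ.ℓ₆ + 1) * (lamD.toC.toK.layer.n + 1))
    -- (1) LEMMA 1: [I]'s block geometry of the (1.33) index families of the layer
    (dist : TDom 4 ((θ.ℓ₆ + 1) * (lamD.toC.toK.layer.n + 1)) → TPt 4 ((θ.ℓ₆ + 1) * (lamD.toC.toK.layer.n + 1)) → (j : ℕ) →
      TPt 4 ((θ.ℓ₆ + 1) ^ (lamD.toC.toK.layer.k - j) * ((θ.ℓ₆ + 1) * (lamD.toC.toK.layer.n + 1))) → ℝ)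
    {K K' : ℝ}
    (hS0Y : ∀ Y, ∀ a ∈ lamD.toC.toK.layer.S0 Y,
      (pbox (fun i => natLift a i - (5 : ℕ)) (fun i => natLift a i + 1 + (5 : ℕ))).image (proj ((θ.ℓ₆ + 1) * (lamD.toC.toK.layer.n + 1))) ⊆ Y.1)
    (hFsub : ∀ Y a, lamD.toC.toK.layer.F Y a ⊆
      (pbox (fun i => natLift a i - (5 : ℕ)) (fun i => natLift a i + 1 + (5 : ℕ))).image (proj ((θ.ℓ₆ + 1) * (lamD.toC.toK.layer.n + 1))) \
        (pbox (fun i => natLift a i - (4 : ℕ)) (fun i => natLift a i + 1 + (4 : ℕ))).image (proj ((θ.ℓ₆ + 1) * (lamD.toC.toK.layer.n + 1))))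
    (hSq : ∀ Y, ∀ a ∈ lamD.toC.toK.layer.S0 Y, ∀ j, lamD.toC.toK.layer.Sq Y a j ⊆
      (Finset.univ : Finset (TPt 4 ((θ.ℓ₆ + 1) ^ (lamD.toC.toK.layer.k - j) * ((θ.ℓ₆ + 1) * (lamD.toC.toK.layer.n + 1))))).filter
        (fun q => tcoarse ((θ.ℓ₆ + 1) ^ (lamD.toC.toK.layer.k - j)) ((θ.ℓ₆ + 1) * (lamD.toC.toK.layer.n + 1)) q ∈
          (pbox (fun i => natLift a i - (2 : ℕ)) (fun i => natLift a i + 1 + (2 : ℕ))).image (proj ((θ.ℓ₆ + 1) * (lamD.toC.toK.layer.n + 1)))))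
    (hScY : ∀ Y, lamD.toC.toK.layer.Sc Y ⊆ Y.1) (hdist0 : ∀ Y a j q, 0 ≤ lamD.toC.toK.layer.c.δ₀ * dist Y a j q)
    (hdist : ∀ Y a j (n : ℕ) q, q ∉ (pbox (fun i => (((θ.ℓ₆ + 1) ^ (lamD.toC.toK.layer.k - j) : ℕ) : ℤ) * natLift a i - (n + 1 : ℕ))
      (fun i => (((θ.ℓ₆ + 1) ^ (lamD.toC.toK.layer.k - j) : ℕ) : ℤ) * natLift a i + 2 * (((θ.ℓ₆ + 1) ^ (lamD.toC.toK.layer.k - j) : ℕ) : ℤ) - 1 + (n + 1 : ℕ))).image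
        (proj ((θ.ℓ₆ + 1) ^ (lamD.toC.toK.layer.k - j) * ((θ.ℓ₆ + 1) * (lamD.toC.toK.layer.n + 1)))) → lamD.toC.toK.layer.c.δ₀ * lamD.toC.toK.layer.c.M * ((n : ℝ) + 1) ≤ lamD.toC.toK.layer.c.δ₀ * dist Y a j q)
    (hSX : ∀ Y a j q, lamD.toC.toK.layer.SX Y a j q ⊆ (tcubeSys 4 ((θ.ℓ₆ + 1) ^ (lamD.toC.toK.layer.k - j) * ((θ.ℓ₆ + 1) * (lamD.toC.toK.layer.n + 1)))).above q)
    (hSX' : ∀ Y a j q, lamD.toC.toK.layer.SX' Y a j q ⊆ (tcubeSys 4 ((θ.ℓ₆ + 1) ^ (lamD.toC.toK.layer.k - j) * ((θ.ℓ₆ + 1) * (lamD.toC.toK.layer.n + 1)))).above q)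
    (hX0 : ∀ Y, ∀ a ∈ lamD.toC.toK.layer.Sc Y, ∀ j ∈ Finset.range (lamD.toC.toK.layer.k + 1), ∀ q ∈ lamD.toC.toK.layer.Sq' Y a j, ∀ x ∈ lamD.toC.toK.layer.SX' Y a j q,
      x.1.image (tcoarse ((θ.ℓ₆ + 1) ^ (lamD.toC.toK.layer.k - j)) ((θ.ℓ₆ + 1) * (lamD.toC.toK.layer.n + 1))) ⊆ Y.1)
    -- (1) LEMMA 1: per-term analyticity on (1.34)
    (hAnT : ∀ Y, ∀ a ∈ lamD.toC.toK.layer.S0 Y, ∀ X ∈ (lamD.toC.toK.layer.F Y a).powerset, ∀ j ∈ Finset.range (lamD.toC.toK.layer.k + 1), ∀ q ∈ lamD.toC.toK.layer.Sq Y a j,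
      ∀ x ∈ lamD.toC.toK.layer.SX Y a j q, AnalyticOnNhd ℂ (lamD.toC.toK.layer.T Y a X j q x) (lamD.toC.toK.layer.sp1 Y))
    (hAnT' : ∀ Y, ∀ a ∈ lamD.toC.toK.layer.Sc Y, ∀ j ∈ Finset.range (lamD.toC.toK.layer.k + 1), ∀ q ∈ lamD.toC.toK.layer.Sq' Y a j, ∀ x ∈ lamD.toC.toK.layer.SX' Y a j q,
      AnalyticOnNhd ℂ (lamD.toC.toK.layer.T' Y a j q x) (lamD.toC.toK.layer.sp1 Y))
    -- (1) LEMMA 1: thresholds and restrictions on the residual constants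
    (hK : 0 ≤ K) (hK' : 0 ≤ K') (hκ : 0 ≤ lamD.toC.toK.layer.c.κ) (hδ1 : lamD.toC.toK.layer.c.δ < 1)
    (hδκ : 1 ≤ lamD.toC.toK.layer.c.δ * lamD.toC.toK.layer.c.κ) (hκ126 : kappa₀ 64 8 ≤ lamD.toC.toK.layer.c.κ)
    (hκ126' : kappa₀ 64 8 ≤ lamD.toC.toK.layer.c.δ * lamD.toC.toK.layer.c.κ) (hκ₁ : 1 + 2 * Real.log (8 * 12 ^ 3) ≤ lamD.toC.toK.layer.c.κ₁)
    (hκ₁' : 2 + 16 * Real.log 128 ≤ lamD.toC.toK.layer.c.κ₁) (hδ₀M : 10 * Real.exp (-1) ≤ lamD.toC.toK.layer.c.δ₀ * lamD.toC.toK.layer.c.M)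
    (hδ₀M5 : 2 * Real.log 5 ≤ lamD.toC.toK.layer.c.δ₀ * lamD.toC.toK.layer.c.M)
    (hR8 : (1 - lamD.toC.toK.layer.c.δ) * lamD.toC.toK.layer.c.κ ≤ (1 / 4) * (lamD.toC.toK.layer.c.κ₁ - 1))
    (hR9 : (1 - 2 * lamD.toC.toK.layer.c.δ) * lamD.toC.toK.layer.c.κ ≤ (1 / 16) * lamD.toC.toK.layer.c.κ₁)
    -- (1) LEMMA 1: per-term (1.24), (1.30) by reference to [I] (3.54), (3.17), [15] Prop. 4, [13] (3.108); the constants with headroom (1 − θ₁)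
    (h124 : ∀ Y φ, φ ∈ lamD.toC.toK.layer.sp1 Y → ∀ a ∈ lamD.toC.toK.layer.S0 Y, ∀ X ∈ (lamD.toC.toK.layer.F Y a).powerset, ∀ j ∈ Finset.range (lamD.toC.toK.layer.k + 1), ∀ q ∈ lamD.toC.toK.layer.Sq Y a j,
      ∀ x ∈ lamD.toC.toK.layer.SX Y a j q,
        ‖lamD.toC.toK.layer.T Y a X j q x φ‖ ≤ K * (((θ.ℓ₆ + 1 : ℕ) : ℝ) ^ j * (((θ.ℓ₆ + 1 : ℕ) : ℝ) ^ lamD.toC.toK.layer.k)⁻¹) ^ 5 *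
          Real.exp (-(lamD.toC.toK.layer.c.κ₁ - 1) *
            (((Y.1 \ (pbox (fun i => natLift a i - (5 : ℕ)) (fun i => natLift a i + 1 + (5 : ℕ))).image
              (proj ((θ.ℓ₆ + 1) * (lamD.toC.toK.layer.n + 1)))).card : ℝ) + X.card)) *
          Real.exp (-(lamD.toC.toK.layer.c.κ * torusTreeLen x.1)))
    (h130 : ∀ Y φ, φ ∈ lamD.toC.toK.layer.sp1 Y → ∀ a ∈ lamD.toC.toK.layer.Sc Y, ∀ j ∈ Finset.range (lamD.toC.toK.layer.k + 1), ∀ q ∈ lamD.toC.toK.layer.Sq' Y a j,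
      ∀ x ∈ lamD.toC.toK.layer.SX' Y a j q,
        ‖lamD.toC.toK.layer.T' Y a j q x φ‖ ≤ K' * Real.exp (-(1 / 2) * (lamD.toC.toK.layer.c.δ₀ * lamD.toC.toK.layer.c.M) * (((θ.ℓ₆ + 1 : ℕ) : ℝ) ^ j * (((θ.ℓ₆ + 1 : ℕ) : ℝ) ^ lamD.toC.toK.layer.k)⁻¹)⁻¹
            - (1 / 2) * lamD.toC.toK.layer.c.δ₀ * dist Y a j q) *
          Real.exp (-(lamD.toC.toK.layer.c.κ₁ - 1) * ((Y.1 \ x.1.image (tcoarse ((θ.ℓ₆ + 1) ^ (lamD.toC.toK.layer.k - j)) ((θ.ℓ₆ + 1) * (lamD.toC.toK.layer.n + 1)))).card : ℝ)) *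
          Real.exp (-(lamD.toC.toK.layer.c.κ * torusTreeLen x.1)))
    {θ₁ : ℝ} (hθ₁0 : 0 ≤ θ₁) (hθ₁1 : θ₁ < 1)
    (hC : K * K₀ 64 8 * (2 * (6 * ((θ.ℓ₆ + 1 : ℕ) : ℝ)) ^ 4) * Real.exp 1 * Real.exp ((1 / 8) * lamD.toC.toK.layer.c.κ₁ * (12 ^ 4 - 1)) +
        2 * (64 * K') * K₀ 64 8 * 1344 ≤
      (1 - θ₁) * (lamD.toC.toK.layer.c.E₀ * lamD.toC.toK.layer.c.ε₁ * lamD.toC.toK.layer.c.C₁ * lamD.toC.toK.layer.c.M ^ lamD.toC.toK.layer.c.q * Real.exp (lamD.toC.toK.layer.c.C₂ * lamD.toC.toK.layer.c.κ₁)))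
    -- (2) LEMMA 2 (pp. 10–11): the curvature terms; the located per-term data of `B13Lemma2Torus.lemma2Printed_twoTorus'` for the layer's plaquette data
    (hGlAn : ∀ Y, AnalyticOnNhd ℂ (lamD.toC.toK.layer.Gl Y) (lamD.toC.toK.layer.sp1 Y))
    (hGl : ∀ Y φ, φ ∈ lamD.toC.toK.layer.sp1 Y → ‖lamD.toC.toK.layer.Gl Y φ‖ ≤ θ₁ * (lamD.toC.toK.layer.c.E₀ * lamD.toC.toK.layer.c.ε₁ * lamD.toC.toK.layer.c.C₁ * lamD.toC.toK.layer.c.M ^ lamD.toC.toK.layer.c.q * Real.exp (lamD.toC.toK.layer.c.C₂ * lamD.toC.toK.layer.c.κ₁)) *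
      Real.exp (-((1 - 2 * lamD.toC.toK.layer.c.δ) * lamD.toC.toK.layer.c.κ * (tsys 4 ((θ.ℓ₆ + 1) * (lamD.toC.toK.layer.n + 1))).dj Y)))
    (he : ∀ Y b, ‖lamD.toC.toK.layer.e Y b‖ ≤ 1) (hg : lamD.toC.toK.layer.g ≠ 0) {R K₂ : ℝ} {m₂ : ℕ} (hK₂ : 0 ≤ K₂) (hR : 0 < R)
    (hε3 : 3 * lamD.toC.toK.layer.c.ε₁ ≤ R)
    (hW : ∀ Y, ∀ i ∈ lamD.toC.toK.layer.s Y, ∀ φ ∈ lamD.toC.toK.layer.sp1 Y, AnalyticOnNhd ℂ (lamD.toC.toK.layer.Wf Y i φ) (ball 0 R))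
    (hKW : ∀ Y, ∀ i ∈ lamD.toC.toK.layer.s Y, ∀ φ ∈ lamD.toC.toK.layer.sp1 Y, ∀ z ∈ ball (0 : lamD.toC.toK.layer.E) R,
      ‖lamD.toC.toK.layer.Wf Y i φ z‖ ≤ K₂ * Real.exp (-(lamD.toC.toK.layer.c.κ₁ - 1) * ((Y.1.card : ℝ) - 1)) * ‖z‖ ^ 3)
    (hcard : ∀ Y, (lamD.toC.toK.layer.s Y).card ≤ m₂ * Y.1.card)
    (hsp : ∀ Y φ, φ ∈ lamD.toC.toK.layer.sp1 Y → ‖lamD.toC.toK.layer.g‖ * ‖lamD.toC.toK.layer.rd Y φ‖ < lamD.toC.toK.layer.c.ε₁)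
    (hfloor : 27 * m₂ * K₂ * Real.exp (lamD.toC.toK.layer.c.κ₁ - 1) ≤ lamD.toC.toK.layer.c.C₃ * lamD.toC.toK.layer.c.M ^ 4 * Real.exp (lamD.toC.toK.layer.c.C₂ * lamD.toC.toK.layer.c.κ₁))
    (hAnP : ∀ Y, ∀ i ∈ lamD.toC.toK.layer.s Y, AnalyticOnNhd ℂ (fun φ => scaled lamD.toC.toK.layer.g (lamD.toC.toK.layer.Wf Y i φ) (lamD.toC.toK.layer.rd Y φ)) (lamD.toC.toK.layer.sp1 Y))
    (hG : ∀ Y, lamD.toC.toK.layer.GaugeInv (lamD.toC.toK.layer.V Y) ∧ lamD.toC.toK.layer.GaugeInv ((WtOfRecord θ lamD.toC.toK.layer).toStepData.quadForm Y) ∧ lamD.toC.toK.layer.GaugeInv (lamD.toC.toK.layer.Vpp Y))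
    -- (3) LEMMA 3 (pp. 14–20): the signs of (2.18)–(2.20), R12, |τ(Y)| ≥ 2, and the numerics bundle at ℓ = ½L
    (hL8 : 8 ≤ θ.ℓ₆ + 1) {a a₂ a₂' a₅ Aabs : ℝ}
    (hN : Lemma3Numerics (c13OfRecord θ lamD.toC.toK.layer) (lamD.toC.toK.layer.m₃ + 1) (((θ.ℓ₆ + 1 : ℕ) : ℝ) / 2) a a₂ a₂' a₅ Aabs)
    (h12 : R12 (c13OfRecord θ lamD.toC.toK.layer)) (hE : 0 < lamD.toC.toK.layer.c.E₀) (hε : 0 < lamD.toC.toK.layer.c.ε₁)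
    (hC₁ : 0 < lamD.toC.toK.layer.c.C₁) (hα : 0 < lamD.toC.toK.layer.c.α₄) (hM : 1 ≤ lamD.toC.toK.layer.c.M)
    (hτ2 : lamD.toC.toK.layer.c.E₀ * lamD.toC.toK.layer.c.ε₁ * lamD.toC.toK.layer.c.C₁ * lamD.toC.toK.layer.c.α₄⁻¹ * lamD.toC.toK.layer.c.M ^ lamD.toC.toK.layer.c.q * Real.exp (lamD.toC.toK.layer.c.C₂ * lamD.toC.toK.layer.c.κ₁) ≤ 1 / 2)
    -- (3) the Cauchy radius and the parameter domains (p. 15)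
    -- the bigger σ-polydisc (a second constants record `cp` lending its `κ₁`; NODE A's kernels are tagged at `cp`) and a
    -- Cauchy radius `r ≤ 1`; the τ-regions are the open discs of radii `2|τ(Y)|` (chosen inside)
    (cp : B13.Consts) (hκp : lamD.toC.toK.layer.c.κ₁ < cp.κ₁) (hr : 0 < lamD.toC.toK.r) (hr1 : lamD.toC.toK.r ≤ 1)
    -- (3) THE DICTIONARY IS def-B13's KERNEL TOWER (`lamD.toC.toK.𝒦 ∕ uOf ∕ r ∕ lZ ∕ lD ∕ Gam ∕ chiY₀ ∕ chicP ∕ Pl ∕ rP ∕ Vr ∕ emb`, `Dfam := 𝐃`; `Γ(σ) = G(σ)·` is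
    --     `ResidB13K.Gam_eq`): only the configuration size `α` and the `|P|` row-bond count stay located
    {α : ℝ} (hαnn : 0 ≤ α)
    (huα : ∀ Z, ∀ t ∈ terms (θ.ℓ₆ + 1) (lamD.toC.toK.layer.m₃ + 1) Z, ∀ φ ∈ lamD.toC.toK.layer.sp2 Z, ‖lamD.toC.toK.uOf Z t φ‖ ≤ α)
    (hPcard : ∀ Z, ∀ t ∈ terms (θ.ℓ₆ + 1) (lamD.toC.toK.layer.m₃ + 1) Z, (lamD.toC.toK.Pl Z t).card = t.2.card)
    -- (3) the record's objects behind the terms: bonds, cubes, the real field inside the configurations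
    (ιb : (Z : TDom 4 (lamD.toC.toK.layer.n + 1)) → (t : Finset (TDom 4 ((θ.ℓ₆ + 1) * (lamD.toC.toK.layer.n + 1))) × Finset (TBond 4 (lamD.toC.toK.layer.m₃ + 1) ((θ.ℓ₆ + 1) * (lamD.toC.toK.layer.n + 1)))) → (lamD.toC.toK.𝒦 Z t).Λ → lamD.toC.toK.layer.Bond)
    (hι : ∀ Z t, Function.Injective (ιb Z t)) (cube : lamD.toC.toK.layer.Bond → TPt 4 ((θ.ℓ₆ + 1) * (lamD.toC.toK.layer.n + 1)))
    (hQsupp : ∀ (Y : TDom 4 ((θ.ℓ₆ + 1) * (lamD.toC.toK.layer.n + 1))) φ b b', lamD.toC.toK.layer.Q Y φ b b' ≠ 0 → cube b ∈ Y.1 ∧ cube b' ∈ Y.1) {m' : ℕ}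
    (hfibc : ∀ Z t (x : TPt 4 ((θ.ℓ₆ + 1) * (lamD.toC.toK.layer.n + 1))), (Finset.univ.filter fun j => cube (ιb Z t j) = x).card ≤ m')
    (hBv : ∀ Z t φ B b, lamD.toC.toK.layer.Bv (lamD.toC.toK.emb Z t φ B) (ιb Z t b) = (B b : ℂ))
    (hBv0 : ∀ Z t φ B b', b' ∉ Set.range (ιb Z t) → lamD.toC.toK.layer.Bv (lamD.toC.toK.emb Z t φ B) b' = 0)
    (hχsupp : ∀ Z, ∀ t ∈ terms (θ.ℓ₆ + 1) (lamD.toC.toK.layer.m₃ + 1) Z, ∀ φ ∈ lamD.toC.toK.layer.sp2 Z, ∀ B, lamD.toC.toK.chiY₀ Z t B ≠ 0 → ∀ Y ∈ t.1,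
      lamD.toC.toK.emb Z t φ B ∈ lamD.toC.toK.layer.sp1 Y)
    -- (3) measurability of the layer's potentials and small-field region in the bond variables (`χ_{k,Y₀}` of record IS measurable, §0)
    (hVm : ∀ Z t φ Y, Measurable (lamD.toC.toK.Vr Z t φ Y))
    (hsmallm : ∀ Z t φ, MeasurableSet {B : (lamD.toC.toK.𝒦 Z t).Λ → ℝ | ∀ Y ∈ t.1, lamD.toC.toK.emb Z t φ B ∈ lamD.toC.toK.layer.sp1 Y}) {γ₂ : ℝ}
    (hγ₂ : 0 ≤ γ₂)
    -- (3) uniform fibre bounds of the bond locations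
    {m : ℕ} (hfibN : ∀ Z t (x : UT lamD.toC.toK.Nf), (Finset.univ.filter fun j => (lamD.toC.toK.𝒦 Z t).locN j = x).card ≤ m)
    -- (3) THE REFERENCE RUNG ON THE TERMS OF THE STEP OF RECORD (the displayed hypothesis, n10-b's reference currency):
    --     ONE admissible reference package `rf`, an accretivity radius `0 < R₁ < R`, print's two perturbative sources (p. 15:
    --     «O(1)e^{−⅓δ₀M} + O(α₀ + α₁)» against the reference positivity) as FOUR DIVISION-FREE THRESHOLDS, positive input
    --     rates and `η ≤ etaMax` of the W-walks package `rf.toWalkPackage R₁` (standard rate book: `κ_C = κ_C⋆`, `ρ′ = μ∕4`),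
    --     `TermWalksRef` for the kernels of every term, round letters, and PRINT's TWO EXCHANGE THRESHOLDS for a `θ₀ > 0`
    (rf : RefPackage) (hrf : rf.Admissible) {R₁ : ℝ} (hR₁ : 0 < R₁) (hR₁R : R₁ < rf.R)
    (hPσ : 8 * rf.KbarP * rf.cV₀ * Real.exp (-(rf.εP * rf.Rσ)) ≤ rf.m₀) (hP₁ : 8 * rf.KbarP * rf.cV₀ * R₁ ≤ rf.m₀ * rf.R)
    (hAσ : 8 * rf.KbarA * rf.cV * Real.exp (-(rf.εA * rf.Rσ)) ≤ rf.mA₀) (hA₁ : 8 * rf.KbarA * rf.cV * R₁ ≤ rf.mA₀ * rf.R)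
    (hp : (rf.toWalkPackage R₁).PositiveRates) (hη : rf.η ≤ (rf.toWalkPackage R₁).etaMax) (hαR : α < R₁)
    -- (3) NODE A's KERNEL DATA READ OFF ONE OPERATOR PER TERM — print's `C*Δ_k(σ(Z),𝐔,𝐉)C` after the conditioning (2.5)–(2.6): block
    --     reading; ONE expansion at `rf`'s full-precision letters whose terms are `s`-MONOMIALS times σ-free operators ([II] p. 3) and
    --     carry a WALK REVERSAL ([13] (3.107)); ONE positivity; geometry; dominations in `rf`
    (hKX : ∀ Z, ∀ t ∈ terms (θ.ℓ₆ + 1) (lamD.toC.toK.layer.m₃ + 1) Z, (lamD.toC.toK.𝒦 Z t).X.Nonempty)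
    -- (3″) NODE A's OBJECT DATA AS ENTRYWISE LETTERS (census v5 class A2′ in its ENTRYWISE form ∧ A2″ as ONE geometric letter ∧ A2‴; replaces
    --      module 21's `hKexp`; ym-nodeO-ideate P2 g30's reduction, tree module `B13EntrywiseWalks`): per term, the fine-bond index `lamD.P Z t` located by
    --      `locF`; TWO ENTRYWISE LETTERS of the σ-free fluctuation operator `lamD.Δ₀ Z t` on the complex `rf.R`-ball — (3.108)-type decay
    --      `‖Δ₀(u)_{ij}‖ ≤ B·e^{−ρ·d₁(i,j)}` and entrywise holomorphy (`RawEntryLetters`) —, a fibre bound; the cube decoration `J` on PAIRS of fine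
    --      bonds with the GEODESIC letter (`|J(i,j)| ≤ c₀ + d₁(i,j)∕M₁`, a decorated pair joined by a `d₁`-geodesic through `(lamD.toC.toK.𝒦 Z t).X`); the (1.11)
    --      numerics `0 < η ≤ ε < ρ`, `2κ₁ ≤ ηM₁`; the REAL constant local averaging operator `lamD.Cm Z t` of (2.5) (`|C| ≤ 1`, range `rC`); a junction
    --      rate `μΔ`; the letter match with `rf`; and `lamD.toC.KK Z t` IS `Cᵀ·sDecorate(J′, ½raw ⊕ ½rawᵀ)·C` (`hKK`)
    {ρΔ BΔ εΔ κΔ ηΔ μΔ M₁ rC : ℝ} {mF c₀ : ℕ}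
    (hEL : ∀ Z, ∀ t ∈ terms (θ.ℓ₆ + 1) (lamD.toC.toK.layer.m₃ + 1) Z, RawEntryLetters (lamD.Δ₀ Z t) (lamD.locF Z t) rf.R ρΔ BΔ)
    (hfibF : ∀ Z t (y : UT lamD.toC.toK.Nf), (Finset.univ.filter fun k => lamD.locF Z t k = y).card ≤ mF)
    (hGJ : ∀ Z, ∀ t ∈ terms (θ.ℓ₆ + 1) (lamD.toC.toK.layer.m₃ + 1) Z, GeodesicDecoration (lamD.J Z t) (lamD.locF Z t) (lamD.toC.toK.𝒦 Z t).X c₀ M₁)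
    (hηΔ : 0 < ηΔ) (hηε : ηΔ ≤ εΔ) (hρε : εΔ < ρΔ) (hP2 : 2 * cp.κ₁ ≤ ηΔ * M₁) (hCle : ∀ Z t k i, |lamD.Cm Z t k i| ≤ 1)
    (hCsupp : ∀ Z t k i, lamD.Cm Z t k i ≠ 0 → tdist1 lamD.toC.toK.Nf (lamD.locF Z t k) ((lamD.toC.toK.𝒦 Z t).locN i) ≤ rC) (hμΔ : 0 < μΔ)
    (hμε : 2 * μΔ ≤ εΔ - ηΔ) (hμκ : 2 * μΔ ≤ κΔ) (hκεΔ : κΔ ≤ ρΔ - εΔ) (hεP : rf.εP ≤ εΔ - ηΔ - μΔ - μΔ) (hkapP : rf.kapP ≤ κΔ - μΔ - μΔ)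
    (hKP : (mF * B6.c0 1 μΔ ^ lamD.toC.toK.ν) * ((mF * B6.c0 1 μΔ ^ lamD.toC.toK.ν) * Real.exp ((ρΔ - ηΔ) * rC) *
      (Real.exp (cp.κ₁ * (2 * c₀ : ℕ)) * (BΔ * (mF * mF + 1))) * B6.c0 1 μΔ ^ lamD.toC.toK.ν) *
      Real.exp ((ρΔ - ηΔ - μΔ) * rC) * B6.c0 1 μΔ ^ lamD.toC.toK.ν ≤ rf.KbarP)
    (hKacc : ∀ Z, ∀ t ∈ terms (θ.ℓ₆ + 1) (lamD.toC.toK.layer.m₃ + 1) Z, ∀ v : (lamD.toC.toK.𝒦 Z t).Λ ⊕ (lamD.toC.toK.𝒦 Z t).C₀ → ℂ,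
      rf.m₀ * ∑ i, ‖v i‖ ^ 2 ≤ (∑ i, star (v i) * (lamD.toC.KK Z t 0 0 *ᵥ v) i).re)
    (hKfar : ∀ Z, ∀ t ∈ terms (θ.ℓ₆ + 1) (lamD.toC.toK.layer.m₃ + 1) Z, ∀ k, ∀ z ∈ (lamD.toC.toK.𝒦 Z t).X, rf.Rσ ≤ tdist1 lamD.toC.toK.Nf ((lamD.toC.toK.𝒦 Z t).locN k) z)
    (hKmult : ∀ Z, ∀ t ∈ terms (θ.ℓ₆ + 1) (lamD.toC.toK.layer.m₃ + 1) Z, ∀ x : UT lamD.toC.toK.Nf,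
      (Finset.univ.filter fun k => (lamD.toC.toK.𝒦 Z t).locN k = x).card ≤ rf.nB)
    (hKdim : lamD.toC.toK.ν ≤ rf.dm) (hεL : rf.εL ≤ rf.εP) (hκL : rf.kapL ≤ rf.kapP) (hKL : rf.KbarP ≤ rf.KbarL) (hεA : rf.εA ≤ rf.εP)
    (hκA : rf.kapA ≤ rf.kapP) (hKA : rf.KbarP ≤ rf.KbarA) (hmA : rf.mA₀ ≤ rf.m₀) {θ₀ : ℝ} (hθ₀ : 0 < θ₀)
    (hαsmall : α ≤ θ₀ * R₁ / (4 * (rf.toWalkPackage R₁).Kbar + 4))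
    (hRσlarge : Real.log ((4 * (rf.toWalkPackage R₁).Kbar + 4) / θ₀)
      / ((rf.toWalkPackage R₁).mu / 4 - (rf.toWalkPackage R₁).kapCStar) ≤ rf.Rσ)
    -- (3) THE (2.24)–(2.25) SMALLNESS AS n10-w1's THREE LOCATED NUMERALS (`B13Bound226Numerals`: canonical rate chain `j·κ_C⋆∕5`,
    --     `ϑ := theta`, `K_G := K̄`, `K_Cs := 8∕m_{A,0}`, `c_E := 2∕m_{A,0}`): `θ₀ ≤ θ₀max`, `γ₂ ≤ γ₂max`, `M⁴min ≤ M⁴`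
    (hθle : θ₀ ≤ theta0Max m lamD.toC.toK.ν (rf.toWalkPackage R₁).kapCStar (rf.toWalkPackage R₁).Kbar (8 / rf.mA₀) (2 / rf.mA₀) (rf.toWalkPackage R₁).BΓ
      rf.cV (B6.c0 1 rf.η) rf.mA₀)
    (hγle : γ₂ ≤ gamma2Max m lamD.toC.toK.ν (2 / rf.mA₀) (rf.toWalkPackage R₁).BΓ rf.cV (B6.c0 1 rf.η) rf.mA₀)
    (hM4 : m4Min m lamD.toC.toK.ν m' (2 / rf.mA₀) (rf.toWalkPackage R₁).BΓ rf.cV (B6.c0 1 rf.η) rf.mA₀ lamD.toC.toK.layer.c.α₄ lamD.toC.toK.layer.c.κ₁ ≤ lamD.toC.toK.layer.c.M ^ 4)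
    -- (3) constant matching, p. 17: `a ≤ γ₂ r_P²` and the volume factor with `w = 2·K₀(64,8)·α₄·#(⋃𝐃)`
    (hPa : a ≤ γ₂ * lamD.toC.toK.rP ^ 2)
    -- (3) the volume factor in θ-FREE COUNT FORM (`B13Bound226Numerals.vol_of_counts`): `2|Λ| + ½|Λ ⊕ C₀| + 2K₀(64,8)α₄·#⋃𝐃 ≤ a₅|Z|`
    (hcount : ∀ Z, ∀ t ∈ terms (θ.ℓ₆ + 1) (lamD.toC.toK.layer.m₃ + 1) Z,
      2 * (Fintype.card (lamD.toC.toK.𝒦 Z t).Λ : ℝ) + (Fintype.card ((lamD.toC.toK.𝒦 Z t).Λ ⊕ (lamD.toC.toK.𝒦 Z t).C₀) : ℝ) / 2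
        + 2 * (K₀ 64 8 * lamD.toC.toK.layer.c.α₄ * ((((t.1).image Subtype.val).biUnion id).card : ℝ)) ≤ a₅ * ((Z.1).card : ℝ)) :
    B13LeafOfRecord θ lamD.toC.toK.layer :=
  b13LeafOfRecord_layer_of_located_entrywise_numerals θ lamD.toC.toK
    hN12 dist hS0Y hFsub hSq hScY hdist0 hdist hSX hSX' hX0 hAnT hAnT' hK hK' hκ hδ1 hδκ hκ126 hκ126' hκ₁ hκ₁' hδ₀M hδ₀M5 hR8 hR9 h124 h130 hθ₁0
    hθ₁1 hC hGlAn hGl he hg hK₂ hR hε3 hW hKW hcard hsp hfloor hAnP hG hL8 hN h12 hE hε hC₁ hα hM hτ2 cp hκp hr hr1 hαnn huα hPcard ιb hι cube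
    hQsupp hfibc hBv hBv0 hχsupp hVm hsmallm hγ₂ (lamD.toC.toK_hfibΛ_of_hfibN hfibN) hfibN rf hrf hR₁ hR₁R hPσ hP₁ hAσ hA₁ hp hη hαR lamD.toC.KK
    lamD.toC_hKA2 lamD.toC_hKG2 lamD.toC_hKloc hKX lamD.P lamD.locF lamD.Δ₀ hEL hfibF lamD.J hGJ hηΔ hηε hρε hP2 lamD.Cm hCle hCsupp hμΔ hμε hμκ
    hκεΔ hεP hkapP hKP lamD.toC_hKK hKacc hKfar hKmult hKdim hεL hκL hKL hεA hκA hKA hmA hθ₀ hαsmall hRσlarge hθle hγle hM4 hPa hcount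

end DecLayer

end Summit.QuantumFields.YangMills.BalabanUVNodes.N10B13KernelTowerWalksEntrywiseNumeralsDecorated

end
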